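import Summits.BirchSwinnertonDyer.BirchSwinnertonDyer.Theorems.ThetaPartnerAtTwoSignedKatoUpToAtTwoLocalCoresCompat
import Literature.GroupTheory.PadicIntCompactImageProofs
import Literature.NumberTheory.GaloisRepresentations.CyclotomicTowerLocalIndex
import Literature.NumberTheory.GaloisRepresentations.AbsGaloisGroupCompact
import HarnessLib

/-!
# Sketch (stub-ideation `sidea-stub_cmLambdaLower-4` g12, family 3 «assume the opposite / small cases»)
# K-d's ONE new lemma `hsurj_w` — PROVED from the tree's trivial-or-open dichotomy — WITH ITS SHARP
# THRESHOLD (the «opposite» below `n_w` is a theorem), the finset-uniform level, and the `n_ℓ` table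

Crux `ResidualThetaCountLowerPureAtTwo` (stmt-BirchSwinnertonDyer-26074), stub `stub_cmLambdaLower`
(= route item `ResidualSignedLambdaLowerCMAtTwo`, stmt-22608), skeleton `Lines/bt26_lambda.lean` v6;
STUB-PLAN rev 13 S51/Q55 (K-d = `map_resGalSubgroupOfEmb_layerCores (closureEmb ℚ_w) κ ρ n hcov` +
`forall_exists_layer_of_surjective` + NEW `hsurj_w`).  HONEST FRAMING: theorems only, no `sorry`, no definition,
no instance; nothing here closes an item; BSD is NOT proved by any of this.

* §1 `exists_threshold` — GENERIC (any field `K`, any `K`-field `E`, any embedding `ι`, any `ℤ_p`-extension `κ`,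
  ONE non-trivial value of `κ ∘ res`): there is `e` with (a) for `n ≥ e` every `u ∈ Γ_n` has `κ u = κ (res t)` for
  some `t ∈ Γ_E` (= S51's `hsurj_w`), and (b) for `n < e` some `u ∈ Γ_n` has `(res t)⁻¹ u ∉ Γ_{n+1}` for EVERY
  `t ∈ Γ_E` — the one-coset hypothesis `hcov` of `map_resGalSubgroupOfEmb_layerCores` FAILS below the threshold.
  Proof: `Literature.GroupTheory.kappa_eq_one_or_exists_image_eq_span_pow` (image of the compact `Γ_E` is `1` or
  exactly `p^e ℤ_p`).
* §2 cyclotomic towers of number fields at EVERY finite place (`exists_apply_resGal_ne_one_of_isCyclotomic'`):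
  `hsurj_w`, `hcov_w` in the exact binder shape of `map_resGalSubgroupOfEmb_layerCores`, and the FINSET-UNIFORM level
  `N₀(S)` (one level for all `w ∈ S₁ = {2} ∪ S₀`, as the EH interior's orbit sum needs).
* §3 small cases (numerology, `decide`): the split depth `n_ℓ = v₂(ℓ² − 1) − 3` of an odd prime in `ℚ_∞ = ⋃ ℚ(ζ_{2^{n+2}})⁺`
  for the census primes `ℓ ∈ {3, 5, 7, 17, 19, 23, 31, 41}` as the pair of congruences `ℓ² ≡ 1 (2^{n_ℓ+3})`,
  `ℓ² ≢ 1 (2^{n_ℓ+4})`; the Galois-theoretic reading (index of the decomposition group `= 2^{n_ℓ}`) is NOT proved here.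
-/

set_option autoImplicit false
set_option linter.dupNamespace false

noncomputable section

open scoped Classical NumberField

namespace Summit.BirchSwinnertonDyer.BirchSwinnertonDyer.Cruxes.ResidualThetaCountLowerPureAtTwo.SideaK4G12

open Field NumberField IsDedekindDomain Multiplicative
  Literature.NumberTheory.EllipticCurves Literature.NumberTheory.GaloisRepresentations ZpExtension
  Summit.BirchSwinnertonDyer.BirchSwinnertonDyer.Theorems.SignedKatoOffTwo.LocalCores

universe u

/-! ## §1 Generic: the sharp threshold of the one-coset hypothesis -/

section Generic

variable {K : Type u} [Field K] {E : Type u} [Field E] [Algebra K E]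
  (ι : AlgebraicClosure K →ₐ[K] AlgebraicClosure E) {p : ℕ} [hp : Fact p.Prime] (κ : ZpExtension K p)

/-- **(hsurj, generic) Above the image exponent every layer value is a local value.** If `κ ∘ res_ι` is not
trivial on `Γ_E`, there is `e` such that for all `n ≥ e` and `u ∈ Γ_n = κ⁻¹(p^n ℤ_p)` some `t ∈ Γ_E` has
`κ (res t) = κ u`.  (`κ(res Γ_E)` is a non-trivial closed subgroup of `ℤ_p`, hence `= p^e ℤ_p ⊇ p^n ℤ_p`.)
[cite: SerreGaloisCohomology1997, I §1.4] [cite: Washington1997, §13.1] -/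
theorem exists_forall_layerSubgroup_exists_apply_resGalOfEmb_eq
    (hne : ∃ t : absoluteGaloisGroup E, κ (resGalOfEmb ι t) ≠ 1) :
    ∃ e : ℕ, ∀ n : ℕ, e ≤ n → ∀ u ∈ κ.layerSubgroup n,
      ∃ t : absoluteGaloisGroup E, κ (resGalOfEmb ι t) = κ u := by
  haveI := absoluteGaloisGroup_compactSpace E
  rcases Literature.GroupTheory.kappa_eq_one_or_exists_image_eq_span_pow
      (κ.toContinuousMonoidHom.comp (resGalOfEmb ι)) with htriv | ⟨e, -, hsurj⟩
  · obtain ⟨t, ht⟩ := hne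
    exact absurd (htriv t) ht
  · refine ⟨e, fun n hn u hu ↦ ?_⟩
    have hu' : toAdd (κ u) ∈ Ideal.span {(p : ℤ_[p]) ^ e} :=
      Ideal.mem_span_singleton.mpr ((pow_dvd_pow _ hn).trans (mem_layerSubgroup.mp hu))
    obtain ⟨t, ht⟩ := hsurj _ hu'
    exact ⟨t, toAdd.injective ht⟩

/-- **(sharp threshold) The one-coset hypothesis holds exactly from the image exponent on.** With `e` the exponent
of the image `κ(res Γ_E) = p^e ℤ_p`: (a) for `n ≥ e` every `u ∈ Γ_n` is `κ`-matched by a local element; (b) for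
`n < e` the element `u ∈ Γ_n` with `κ u = p^n` satisfies `(res t)⁻¹ u ∉ Γ_{n+1}` for EVERY `t ∈ Γ_E` (since
`κ(res t) ∈ p^e ℤ_p ⊆ p^{n+1} ℤ_p`), so the hypothesis `hcov` of `map_resGalSubgroupOfEmb_layerCores` FAILS at
level `n` — «assume the opposite» (a uniform `n₀ = 0`) is refuted whenever `e ≥ 1`.
[cite: SerreGaloisCohomology1997, I §1.4] [cite: NeukirchSchmidtWingberg2008, I §5 (1.5.6)–(1.5.7)] -/
theorem exists_threshold (hne : ∃ t : absoluteGaloisGroup E, κ (resGalOfEmb ι t) ≠ 1) :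
    ∃ e : ℕ,
      (∀ n : ℕ, e ≤ n → ∀ u ∈ κ.layerSubgroup n, ∃ t : absoluteGaloisGroup E, κ (resGalOfEmb ι t) = κ u) ∧
      (∀ n : ℕ, n < e → ∃ u ∈ κ.layerSubgroup n,
        ∀ t : absoluteGaloisGroup E, (resGalOfEmb ι t)⁻¹ * u ∉ κ.layerSubgroup (n + 1)) := by
  haveI := absoluteGaloisGroup_compactSpace E
  rcases Literature.GroupTheory.kappa_eq_one_or_exists_image_eq_span_pow
      (κ.toContinuousMonoidHom.comp (resGalOfEmb ι)) with htriv | ⟨e, hle, hsurj⟩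
  · obtain ⟨t, ht⟩ := hne
    exact absurd (htriv t) ht
  refine ⟨e, fun n hn u hu ↦ ?_, fun n hn ↦ ?_⟩
  · have hu' : toAdd (κ u) ∈ Ideal.span {(p : ℤ_[p]) ^ e} :=
      Ideal.mem_span_singleton.mpr ((pow_dvd_pow _ hn).trans (mem_layerSubgroup.mp hu))
    obtain ⟨t, ht⟩ := hsurj _ hu'
    exact ⟨t, toAdd.injective ht⟩
  · -- `u` with `κ u = p^n`
    obtain ⟨u, hu⟩ := κ.surjective (ofAdd ((p : ℤ_[p]) ^ n))
    have hκu : κ u = ofAdd ((p : ℤ_[p]) ^ n) := hu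
    refine ⟨u, mem_layerSubgroup.mpr (by rw [hκu, toAdd_ofAdd]), fun t hmem ↦ ?_⟩
    -- `κ(res t) = p^e c`
    have ht : toAdd (κ (resGalOfEmb ι t)) ∈ Ideal.span {(p : ℤ_[p]) ^ e} := hle t
    obtain ⟨c, hc⟩ := Ideal.mem_span_singleton.mp ht
    -- `p^{n+1} ∣ p^n - p^e c`
    have hdiv := mem_layerSubgroup.mp hmem
    rw [map_mul, map_inv, toAdd_mul, toAdd_inv, hκu, toAdd_ofAdd, hc] at hdiv
    -- write `e = n + 1 + d`
    obtain ⟨d, rfl⟩ := Nat.exists_eq_add_of_le (Nat.lt_iff_add_one_le.mp hn)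
    have h1 : (p : ℤ_[p]) ^ (n + 1) ∣ (p : ℤ_[p]) ^ (n + 1 + d) * c :=
      (pow_dvd_pow _ (Nat.le_add_right _ _)).mul_right c
    have h2 : (p : ℤ_[p]) ^ (n + 1) ∣ (p : ℤ_[p]) ^ n := by
      have h4 := dvd_sub hdiv h1.neg_right
      have h3 : -((p : ℤ_[p]) ^ (n + 1 + d) * c) + (p : ℤ_[p]) ^ n - -((p : ℤ_[p]) ^ (n + 1 + d) * c) =
          (p : ℤ_[p]) ^ n := by ring
      rwa [h3] at h4
    -- contradiction: `p^{n+1} ∤ p^n` in `ℤ_p` (`p` is a non-zero non-unit)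
    have hp0 : (p : ℤ_[p]) ≠ 0 := by exact_mod_cast hp.out.ne_zero
    have hpu : ¬ IsUnit (p : ℤ_[p]) := (PadicInt.irreducible_p (p := p)).not_isUnit
    have := (pow_dvd_pow_iff hp0 hpu).mp h2
    omega

end Generic

/-! ## §2 The cyclotomic `ℤ_p`-tower of a number field at ANY finite place -/

section Cyclotomic

variable {K : Type} [Field K] [NumberField K] {p : ℕ} [hp : Fact p.Prime] {κ : ZpExtension K p}

/-- **`hsurj_w` (S51/Q55) at every finite place `w` of a number field, for the cyclotomic `ℤ_p`-extension**:
`∃ n_w, ∀ n ≥ n_w, ∀ u ∈ Γ_n, ∃ t ∈ Γ_{K_w}, κ (res t) = κ u` — from §1 and the non-triviality of `κ` on every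
decomposition group (`exists_apply_resGal_ne_one_of_isCyclotomic'`: no finite place splits completely in `K_∞`).
[cite: GreenbergLNM1716, §1] [cite: Washington1997, §13.1] -/
theorem exists_forall_layerSubgroup_exists_apply_resGalOfEmb_adicCompletion_eq (hκ : κ.IsCyclotomic)
    (w : HeightOneSpectrum (𝓞 K)) :
    ∃ n₀ : ℕ, ∀ n : ℕ, n₀ ≤ n → ∀ u ∈ κ.layerSubgroup n,
      ∃ t : absoluteGaloisGroup (w.adicCompletion K),
        κ (resGalOfEmb (closureEmb (K := K) (w.adicCompletion K)) t) = κ u :=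
  exists_forall_layerSubgroup_exists_apply_resGalOfEmb_eq (closureEmb (K := K) (w.adicCompletion K)) κ
    (exists_apply_resGal_ne_one_of_isCyclotomic' K p hκ w)

/-- **`hcov_w`: the one-coset hypothesis of `map_resGalSubgroupOfEmb_layerCores` at every finite place, for all
large levels** — in that theorem's exact binder shape (`forall_exists_layer_of_surjective ∘ hsurj_w`).  K-d (a) at
`w` and level `n ≥ n_w` is then `map_resGalSubgroupOfEmb_layerCores (closureEmb K_w) κ T n (this n hn)`.
[cite: Kato2004Asterisque, §12.2 (p. 220)] [cite: Washington1997, §13.1] -/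
theorem exists_forall_hcov (hκ : κ.IsCyclotomic) (w : HeightOneSpectrum (𝓞 K)) :
    ∃ n₀ : ℕ, ∀ n : ℕ, n₀ ≤ n → ∀ u ∈ κ.layerSubgroup n,
      ∃ t ∈ localSubgroupOfEmb (κ.layerSubgroup n) (closureEmb (K := K) (w.adicCompletion K)),
        (resGalOfEmb (closureEmb (K := K) (w.adicCompletion K)) t)⁻¹ * u ∈ κ.layerSubgroup (n + 1) := by
  obtain ⟨n₀, h⟩ := exists_forall_layerSubgroup_exists_apply_resGalOfEmb_adicCompletion_eq hκ w
  exact ⟨n₀, fun n hn ↦ forall_exists_layer_of_surjective (closureEmb (K := K) (w.adicCompletion K)) κ n (h n hn)⟩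

/-- **Sharpness at a finite place**: with `n_w` the image exponent, `hcov` holds for all `n ≥ n_w` and FAILS for all
`n < n_w` (some `u ∈ Γ_n` escapes every local coset).  So K-d (b)'s single-embedding projection formula is a
statement for `n ≥ n_w` only; below, the localisation of a layer trace is a sum over `p^{min(n,n_w)}`… conjugate
places (the orbit count of the EH bracket (C5)). [cite: NeukirchSchmidtWingberg2008, I §5 (1.5.6)–(1.5.7)] -/
theorem exists_threshold_adicCompletion (hκ : κ.IsCyclotomic) (w : HeightOneSpectrum (𝓞 K)) :
    ∃ n_w : ℕ,
      (∀ n : ℕ, n_w ≤ n → ∀ u ∈ κ.layerSubgroup n,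
        ∃ t ∈ localSubgroupOfEmb (κ.layerSubgroup n) (closureEmb (K := K) (w.adicCompletion K)),
          (resGalOfEmb (closureEmb (K := K) (w.adicCompletion K)) t)⁻¹ * u ∈ κ.layerSubgroup (n + 1)) ∧
      (∀ n : ℕ, n < n_w → ∃ u ∈ κ.layerSubgroup n,
        ∀ t : absoluteGaloisGroup (w.adicCompletion K),
          (resGalOfEmb (closureEmb (K := K) (w.adicCompletion K)) t)⁻¹ * u ∉ κ.layerSubgroup (n + 1)) := by
  obtain ⟨e, ha, hb⟩ := exists_threshold (closureEmb (K := K) (w.adicCompletion K)) κ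
    (exists_apply_resGal_ne_one_of_isCyclotomic' K p hκ w)
  exact ⟨e, fun n hn ↦ forall_exists_layer_of_surjective (closureEmb (K := K) (w.adicCompletion K)) κ n (ha n hn), hb⟩

/-- **One level for finitely many places** (`N₀(S) = max_{w ∈ S} n_w`): the EH interior's orbit sum over
`S₁ = {2} ∪ S₀` is taken at ONE layer `n ≥ N₀(S₁)`, where every `w ∈ S₁` satisfies `hcov`.
[cite: Kato2004Asterisque, §12.2 (p. 220)] [cite: Washington1997, §13.1] -/
theorem exists_forall_mem_finset_hcov (hκ : κ.IsCyclotomic) (S : Finset (HeightOneSpectrum (𝓞 K))) :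
    ∃ N₀ : ℕ, ∀ w ∈ S, ∀ n : ℕ, N₀ ≤ n → ∀ u ∈ κ.layerSubgroup n,
      ∃ t ∈ localSubgroupOfEmb (κ.layerSubgroup n) (closureEmb (K := K) (w.adicCompletion K)),
        (resGalOfEmb (closureEmb (K := K) (w.adicCompletion K)) t)⁻¹ * u ∈ κ.layerSubgroup (n + 1) := by
  choose f hf using fun w : HeightOneSpectrum (𝓞 K) ↦ exists_forall_hcov hκ w
  exact ⟨S.sup f, fun w hw n hn ↦ hf w n ((Finset.le_sup hw).trans hn)⟩

end Cyclotomic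

/-! ## §3 Small cases: the split depth `n_ℓ` of the census primes in `ℚ_∞ = ⋃ₙ ℚ(ζ_{2^{n+2}})⁺` (numerology) -/

/-- `ℓ ≡ ±1 (mod 2^{m})` iff `ℓ² ≡ 1 (mod 2^{m+1})` (`m ≥ 2`); Frobenius at `ℓ` is trivial on `ℚ_n = ℚ(ζ_{2^{n+2}})⁺`
iff `ℓ ≡ ±1 (mod 2^{n+2})`; so `n_ℓ := max {n : ℓ² ≡ 1 (mod 2^{n+3})} = v₂(ℓ² − 1) − 3`.  The table for the
census / level primes `ℓ = 3, 5, 7, 17, 19, 23, 31, 41`: `n_ℓ = 0, 0, 1, 2, 0, 1, 3, 1` — each as the decidable pair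
«`2^{n_ℓ+3} ∣ ℓ² − 1` and `2^{n_ℓ+4} ∤ ℓ² − 1`».  (Reading: `7` splits in `ℚ_1 = ℚ(√2)` — a uniform `n₀ = 0` in
`hsurj_w` is FALSE at `w = 7`; the census pair `{19, 31}` needs the common level `N₀ = 3`, `{19, 23}` needs `N₀ = 1`.)
[cite: Washington1997, §13.1, Prop. 13.2] -/
theorem splitDepth_table :
    (2 ^ 3 ∣ 3 ^ 2 - 1 ∧ ¬ 2 ^ 4 ∣ 3 ^ 2 - 1) ∧ (2 ^ 3 ∣ 5 ^ 2 - 1 ∧ ¬ 2 ^ 4 ∣ 5 ^ 2 - 1) ∧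
    (2 ^ 4 ∣ 7 ^ 2 - 1 ∧ ¬ 2 ^ 5 ∣ 7 ^ 2 - 1) ∧ (2 ^ 5 ∣ 17 ^ 2 - 1 ∧ ¬ 2 ^ 6 ∣ 17 ^ 2 - 1) ∧
    (2 ^ 3 ∣ 19 ^ 2 - 1 ∧ ¬ 2 ^ 4 ∣ 19 ^ 2 - 1) ∧ (2 ^ 4 ∣ 23 ^ 2 - 1 ∧ ¬ 2 ^ 5 ∣ 23 ^ 2 - 1) ∧
    (2 ^ 6 ∣ 31 ^ 2 - 1 ∧ ¬ 2 ^ 7 ∣ 31 ^ 2 - 1) ∧ (2 ^ 4 ∣ 41 ^ 2 - 1 ∧ ¬ 2 ^ 5 ∣ 41 ^ 2 - 1) := by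
  decide

/-- `2` is a square mod `7` (`3² = 2`): the level prime `7` splits in the first layer `ℚ_1 = ℚ(√2)` — the smallest
witness that the threshold `n_w` of `hsurj_w` is place-dependent and not `0`. [cite: Washington1997, §13.1] -/
theorem two_isSquare_mod_seven : ∃ x : ZMod 7, x ^ 2 = 2 := ⟨3, by decide⟩

/-- `2` is NOT a square mod `3`, `5`, `19` (`n_ℓ = 0`: inert in `ℚ(√2)`, so `hsurj_w` holds from `n = 0` — e.g. the
census conductor prime `19` and the level prime `3`). [cite: Washington1997, §13.1] -/
theorem two_not_isSquare_mod_three_five_nineteen :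
    (∀ x : ZMod 3, x ^ 2 ≠ 2) ∧ (∀ x : ZMod 5, x ^ 2 ≠ 2) ∧ (∀ x : ZMod 19, x ^ 2 ≠ 2) := by
  refine ⟨?_, ?_, ?_⟩ <;> decide

end Summit.BirchSwinnertonDyer.BirchSwinnertonDyer.Cruxes.ResidualThetaCountLowerPureAtTwo.SideaK4G12

end
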